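import Summits.KontsevichZagierPeriods.KontsevichZagierPeriods.Theorems.SymplecticScissorsRealOnePeriodRelationsStubManyPathsCoreAux
import HarnessLib

/-!
# Crux `RealOnePeriodRelations` (stmt-KontsevichZagierPeriods-10042), line `nash-retraction-thin-strip`:
# stub `stub_manyPathsCore` — Huber–Wüstholz 13.3 (2) for arbitrary paths on a finite family of
# elliptic curves with `𝔾ₘ` and `𝔸¹`

The FAMILY ENDGAME of the tree's one-curve theorem
`CurvePeriods.huberWustholzCurvePeriods_of_ellipticPaths`
(`Literature/NumberTheory/Transcendental/CurvePeriodsEllipticPathsProofs.lean`): a vanishing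
`ℚ̄`-linear combination `c` of period symbols on the Weierstrass curves `E_{L_j}` (`j ∈ J` finite,
`g₂, g₃ ∈ ℚ̄`, ANY `C¹` paths with algebraic end points), on `𝔾ₘ = {xy = 1}` and on `𝔸¹` lies in the
`ℚ̄`-span of the elementary relations, GIVEN

* `hNF` — the per-curve lift normal form (phases A–D of the one-curve theorem, the neighbouring
  `stub_ellNormalForm`): every finite set of symbols on `E_{L_j}` is, modulo the relations, carried
  by basis lifts `D_l : t₀ ↝ t₀ + m_l` at a generic algebraic base point, with `ℤ`-independent
  algebraic logarithms `m_l` and `(m_l, ζ(t₀ + m_l) − ζ(t₀))` a `ℚ̄`-point of `E♮`;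
* `hALT` — the alternatives at general algebraic points of `G = 𝔾ₐ × 𝔾ₘ^ι × ∏_b E_{L_{cls b}}♮`
  (from Baker–Wüstholz's hyperplane theorem for the quotients of `G`).

Proof: sort the elliptic symbols of the support into classes `T j` (a chosen `j` with
`s.Z = E_{L_j}`), apply `hNF j (T j)`; the symbols on `𝔾ₘ`/`𝔸¹` are `d ℓ(M) + e 𝟙`
(`exists_logSym_rel`), and the logarithms are expanded in a `ℚ`-basis of their `ℚ`-span
(`exists_linearIndependent`, `exists_expPath`, `span_logSym_sum`), exactly as in the one-curve
theorem (Phase E); the endgame with blocks `Σ j, Fin r_j` and classes `Sigma.fst` is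
`manyPathsCore_endgame` of the auxiliary file.

References: A. Huber, G. Wüstholz, *Transcendence and Linear Relations of 1-Periods*, Cambridge
Tracts in Mathematics 227, CUP 2022, Thm. 13.3 (2), §13.2, Ch. 15, Thm. 6.2. [HuberWustholz2022]
-/

noncomputable section

open scoped BigOperators PeriodPair Topology
open MvPolynomial Set Complex Filter Metric
open Literature.NumberTheory.Transcendental Literature.NumberTheory.Transcendental.CurvePeriods

set_option quotPrecheck false in
/-- Membership in the `ℚ̄`-span of the elementary relations (the conclusion format of
`HuberWustholzCurvePeriods`). [cite: HuberWustholz2022, Thm 13.3 (2), §13.2, Ch. 15, Thm 6.2] -/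
local notation "InSpan" c:max => ∃ (k : ℕ) (ρ : Fin k → (PeriodSymbol →₀ ℂ)) (a : Fin k → ℂ),
  (∀ l, IsElementaryRelation (ρ l)) ∧ (∀ l, IsAlgebraic ℚ (a l)) ∧ c = ∑ l, a l • ρ l

namespace Summit.KontsevichZagierPeriods.SymplecticScissors.RealOnePeriodRelations.MultiEllLayer

/-- **Huber–Wüstholz 13.3 (2) for ARBITRARY paths on a finite family of elliptic curves with `𝔾ₘ`
and `𝔸¹`, from the per-curve normal form and the ALTERNATIVES at general algebraic points of
`G = 𝔾ₐ × 𝔾ₘ^ι × ∏_b E_{cls b}♮`** (the family endgame of the tree's `huberWustholzCurvePeriods_of_ellipticPaths`): expand the symbols of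
class `j` through the basis lifts of `stub_ellNormalForm` for `L_j`, the logarithms in a `ℚ`-basis (`exists_logSym_rel`,
`span_logSym_sum`), evaluate (the period of the normal form vanishes), and apply the alternatives at
`u = (e_tot; (log's); (m_l^{(j)}, ζ_j(t₀^{(j)} + m_l^{(j)}) − ζ_j(t₀^{(j)}))_{j,l})` with blocks `B = Σ j, Fin r_j`, `cls = Sigma.fst`:
`1 ≠ 0`, the `ℚ`-independence of the logarithms and the `ℤ`-independence of the `m^{(j)}` class by class exclude them, so all
coefficients vanish (`manyPathsCore_endgame`). [cite: HuberWustholz2022, Thm 13.3 (2), §13.2, Ch. 15, Thm 6.2] -/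
theorem stub_manyPathsCore {J : Type} [Fintype J] [DecidableEq J] (L : J → PeriodPair)
    (hL : ∀ j, IsAlgebraic ℚ (L j).g₂ ∧ IsAlgebraic ℚ (L j).g₃)
    (hNF : ∀ (j : J) (T : Finset PeriodSymbol), (∀ s ∈ T, s.Z = Ell.curve (L j)) →
      ∃ (r : ℕ) (m : Fin r → ℂ) (t₀ : ℂ) (DU : ∀ l : Fin r, Ell.LiftData (L j) t₀ (t₀ + m l)),
        LinearIndependent ℤ m ∧ (∀ l, Ell.AlgLog (L j) (m l)) ∧ Ell.IsAlgPt (L j) t₀ ∧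
        (∀ l, (L j).IsUnivExtAlgPoint (m l) ((L j).weierstrassZeta (t₀ + m l) - (L j).weierstrassZeta t₀)) ∧
        ∀ s ∈ T, ∃ (A B : Fin r → ℂ) (e : ℂ), (∀ l, IsAlgebraic ℚ (A l)) ∧ (∀ l, IsAlgebraic ℚ (B l)) ∧
          IsAlgebraic ℚ e ∧
          InSpan (Finsupp.single s (1 : ℂ) - Ell.liftPart (hL j).1 (hL j).2 DU A B -
            e • Finsupp.single PeriodSymbol.unit (1 : ℂ)))
    (hALT : ∀ (ι B : Type) [Fintype ι] [Fintype B] (cls : B → J) (x : ℂ) (y : ι → ℂ) (z t : B → ℂ),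
      IsAlgebraic ℚ x → (∀ i, IsAlgebraic ℚ (cexp (y i))) → (∀ b, (L (cls b)).IsUnivExtAlgPoint (z b) (t b)) →
      ¬ QbarLinearIndependent (lieCoords x y z t) →
      x = 0 ∨ (∃ p : ι → ℤ, p ≠ 0 ∧ ∑ i, (p i : ℂ) * y i = 0) ∨
        ∃ (i : J) (a : B → ℤ), a ≠ 0 ∧ (∀ b, cls b ≠ i → a b = 0) ∧ ∑ b, (a b : ℂ) * z b = 0)
    (c : PeriodSymbol →₀ ℂ) (hc : ∀ s, IsAlgebraic ℚ (c s))
    (hsupp : ∀ s ∈ c.support,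
      (∃ j, s.Z = Ell.curve (L j)) ∨ s.Z = (⟨2, 1, ![X 0 * X 1 - 1]⟩ : CurveData) ∨ s.Z = CurveData.affineLine)
    (h0 : evalCombination c = 0) :
    InSpan c := by
  classical
  -- the class of an elliptic symbol
  have hcl0 : ∀ s : PeriodSymbol, ∃ o : Option J, (∀ j, o = some j → s.Z = Ell.curve (L j)) ∧
      ((∃ j, s.Z = Ell.curve (L j)) → ∃ j, o = some j) := by
    intro s
    by_cases h : ∃ j, s.Z = Ell.curve (L j)
    · obtain ⟨j, hj⟩ := h
      refine ⟨some j, fun j' hj' => ?_, fun _ => ⟨j, rfl⟩⟩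
      rw [← Option.some_inj.1 hj']
      exact hj
    · exact ⟨none, fun j hj => (Option.some_ne_none j hj.symm).elim, fun h' => (h h').elim⟩
  choose cl hcl1 hcl2 using hcl0
  set T : J → Finset PeriodSymbol := fun j => c.support.filter (fun s => cl s = some j) with hT
  have hTZ : ∀ j, ∀ s ∈ T j, s.Z = Ell.curve (L j) := fun j s hs =>
    hcl1 s j (Finset.mem_filter.1 hs).2
  -- the per-class normal form
  choose r m t₀ DU hli hmA ht₀ hpts hNF' using fun j => hNF j (T j) (hTZ j)
  have keyE : ∀ (j : J) (s : PeriodSymbol), ∃ (A B : Fin (r j) → ℂ) (e : ℂ),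
      (s ∈ T j → ((∀ l, IsAlgebraic ℚ (A l)) ∧ (∀ l, IsAlgebraic ℚ (B l)) ∧ IsAlgebraic ℚ e ∧
        InSpan (Finsupp.single s (1 : ℂ) - Ell.liftPart (hL j).1 (hL j).2 (DU j) A B -
          e • Finsupp.single PeriodSymbol.unit (1 : ℂ)))) ∧
      (s ∉ T j → A = 0 ∧ B = 0) := by
    intro j s
    by_cases hs : s ∈ T j
    · obtain ⟨A, B, e, hA, hB, he, hrel⟩ := hNF' j s hs
      exact ⟨A, B, e, fun _ => ⟨hA, hB, he, hrel⟩, fun h => (h hs).elim⟩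
    · exact ⟨0, 0, 0, fun h => (hs h).elim, fun _ => ⟨rfl, rfl⟩⟩
  choose A B eE hABe hAB0 using keyE
  have hAalg : ∀ j, ∀ s ∈ c.support, ∀ l, IsAlgebraic ℚ (A j s l) := fun j s _ l => by
    by_cases hs : s ∈ T j
    · exact (hABe j s hs).1 l
    · rw [(hAB0 j s hs).1]; exact isAlgebraic_zero
  have hBalg : ∀ j, ∀ s ∈ c.support, ∀ l, IsAlgebraic ℚ (B j s l) := fun j s _ l => by
    by_cases hs : s ∈ T j
    · exact (hABe j s hs).2.1 l
    · rw [(hAB0 j s hs).2]; exact isAlgebraic_zero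
  -- per symbol: `s ∼ Σ_j liftPart_j (A j s) (B j s) + d ℓ(M) + e 𝟙`
  obtain ⟨E00, hE00⟩ := exists_expPath (L₀ := 0) (L₁ := 0) isAlgebraic_exp_zero isAlgebraic_exp_zero
  have key : ∀ s : PeriodSymbol, ∃ (M : ℂ) (E : CurvePath (⟨2, 1, ![X 0 * X 1 - 1]⟩ : CurveData))
      (d e : ℂ), s ∈ c.support →
      (IsAlgebraic ℚ (exp M) ∧
        (∀ t, E.toFun t = ![exp ((1 - t) * 0 + t * M), exp (-((1 - t) * 0 + t * M))]) ∧
        IsAlgebraic ℚ d ∧ IsAlgebraic ℚ e ∧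
        InSpan (Finsupp.single s (1 : ℂ) -
          ∑ j, Ell.liftPart (hL j).1 (hL j).2 (DU j) (A j s) (B j s) -
          d • Finsupp.single
            (⟨⟨2, 1, ![X 0 * X 1 - 1]⟩, isSmoothAffineCurve_mulGroup, ![X 1, 0], hasAlgCoeffs_ydx, E⟩ :
              PeriodSymbol) (1 : ℂ) -
          e • Finsupp.single PeriodSymbol.unit (1 : ℂ))) := by
    intro s
    by_cases hs : s ∈ c.support
    · by_cases hE : ∃ j, s.Z = Ell.curve (L j)
      · obtain ⟨j₀, hj₀⟩ := hcl2 s hE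
        have hmem : s ∈ T j₀ := Finset.mem_filter.2 ⟨hs, hj₀⟩
        obtain ⟨-, -, he, hrel⟩ := hABe j₀ s hmem
        have hEP : ∑ j, Ell.liftPart (hL j).1 (hL j).2 (DU j) (A j s) (B j s) =
            Ell.liftPart (hL j₀).1 (hL j₀).2 (DU j₀) (A j₀ s) (B j₀ s) := by
          refine Finset.sum_eq_single j₀ (fun j _ hj => ?_) (fun h => (h (Finset.mem_univ _)).elim)
          have hn : s ∉ T j := fun h' =>
            hj (Option.some_inj.1 (((Finset.mem_filter.1 h').2).symm.trans hj₀))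
          rw [(hAB0 j s hn).1, (hAB0 j s hn).2, Ell.liftPart_zero]
        refine ⟨0, E00, 0, eE j₀ s, fun _ => ⟨isAlgebraic_exp_zero, hE00, isAlgebraic_zero, he, ?_⟩⟩
        obtain ⟨k, ρ, cf, hρ, hcf, hsum⟩ := hrel
        exact ⟨k, ρ, cf, hρ, hcf, by rw [hEP, ← hsum, zero_smul, sub_zero]⟩
      · have hGA : s.Z = (⟨2, 1, ![X 0 * X 1 - 1]⟩ : CurveData) ∨ s.Z = CurveData.affineLine := by
          rcases hsupp s hs with h | h
          · exact (hE h).elim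
          · exact h
        obtain ⟨M, E, d, e, h1, h2, h3, h4, h5⟩ := exists_logSym_rel s hGA
        have hEP : ∑ j, Ell.liftPart (hL j).1 (hL j).2 (DU j) (A j s) (B j s) = 0 := by
          refine Finset.sum_eq_zero fun j _ => ?_
          have hn : s ∉ T j := fun h' => hE ⟨j, hTZ j s h'⟩
          rw [(hAB0 j s hn).1, (hAB0 j s hn).2, Ell.liftPart_zero]
        refine ⟨M, E, d, e, fun _ => ⟨h1, h2, h3, h4, ?_⟩⟩
        obtain ⟨k, ρ, cf, hρ, hcf, hsum⟩ := h5
        exact ⟨k, ρ, cf, hρ, hcf, by rw [hEP, ← hsum, sub_zero]⟩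
    · exact ⟨0, E00, 0, 0, fun h => (hs h).elim⟩
  choose M E d e hkey using key
  -- the logarithms in a `ℚ`-basis (Phase E of the one-curve theorem)
  set S : Finset ℂ := c.support.image M with hS
  obtain ⟨bq, hbS, hspan, hliq⟩ := exists_linearIndependent ℚ (↑S : Set ℂ)
  have hbfin : bq.Finite := S.finite_toSet.subset hbS
  set Bs : Finset ℂ := hbfin.toFinset with hBs
  have hBb : (↑Bs : Set ℂ) = bq := hbfin.coe_toFinset
  have halgB : ∀ x : Bs, IsAlgebraic ℚ (exp (x : ℂ)) := by
    rintro ⟨x, hx⟩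
    have hx' : x ∈ S := by
      have : x ∈ bq := by rw [← hBb]; exact hx
      exact hbS this
    obtain ⟨s, hs, rfl⟩ := Finset.mem_image.1 hx'
    exact (hkey s hs).1
  have hliB : LinearIndependent ℚ (fun x : Bs => (x : ℂ)) := by
    rw [← hBb] at hliq
    exact hliq
  have keyB : ∀ x : Bs, ∃ Em : CurvePath (⟨2, 1, ![X 0 * X 1 - 1]⟩ : CurveData),
      ∀ t, Em.toFun t = ![exp ((1 - t) * 0 + t * (x : ℂ)), exp (-((1 - t) * 0 + t * (x : ℂ)))] :=
    fun x => exists_expPath (L₀ := 0) (L₁ := (x : ℂ)) isAlgebraic_exp_zero (halgB x)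
  choose Em hEm using keyB
  have keyq : ∀ s : PeriodSymbol, ∃ q : Bs → ℚ, s ∈ c.support →
      ∑ i, (q i : ℂ) * (i : ℂ) = M s := by
    intro s
    by_cases hs : s ∈ c.support
    · have hmem : M s ∈ Submodule.span ℚ (Set.range fun x : Bs => (x : ℂ)) := by
        have hrange : Set.range (fun x : Bs => (x : ℂ)) = (↑Bs : Set ℂ) := Subtype.range_coe
        rw [hrange, hBb, hspan]
        exact Submodule.subset_span (Finset.mem_coe.2 (Finset.mem_image_of_mem M hs))
      obtain ⟨q, hq⟩ := (Submodule.mem_span_range_iff_exists_fun ℚ).1 hmem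
      refine ⟨q, fun _ => ?_⟩
      rw [← hq]
      exact Finset.sum_congr rfl fun i _ => by rw [Rat.smul_def]
    · exact ⟨0, fun h => (hs h).elim⟩
  choose q hq using keyq
  have hqalg : ∀ s ∈ c.support, ∀ i : Bs, IsAlgebraic ℚ (d s * ((q s i : ℚ) : ℂ)) := fun s hs i =>
    (hkey s hs).2.2.1.mul (by simpa using isAlgebraic_algebraMap (R := ℚ) (A := ℂ) (q s i))
  -- per symbol, with the logarithm expanded along the symbols `ℓ i = (𝔾ₘ, y dx, E_{0, i})`
  set ℓ : Bs → PeriodSymbol := fun i =>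
    ⟨⟨2, 1, ![X 0 * X 1 - 1]⟩, isSmoothAffineCurve_mulGroup, ![X 1, 0], hasAlgCoeffs_ydx, Em i⟩ with hℓ
  have hℓper : ∀ i, (ℓ i).period = (i : ℂ) := fun i => by
    rw [hℓ, period_ydx_expPath 0 (i : ℂ) (Em i) (hEm i), sub_zero]
  have hper_s : ∀ s ∈ c.support, InSpan (Finsupp.single s (1 : ℂ) -
      ∑ j, Ell.liftPart (hL j).1 (hL j).2 (DU j) (A j s) (B j s) -
      ∑ i : Bs, (d s * ((q s i : ℚ) : ℂ)) • Finsupp.single (ℓ i) (1 : ℂ) -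
      e s • Finsupp.single PeriodSymbol.unit (1 : ℂ)) := by
    intro s hs
    obtain ⟨_, hEs, hds, _, hrel⟩ := hkey s hs
    have hsum := span_logSym_sum (Finset.univ : Finset Bs) (fun x : Bs => (x : ℂ)) halgB (q s) Em
      (fun i t => hEm i t) (E s) (fun t => by rw [hEs, hq s hs])
    obtain ⟨k, ρ, cf, hρ, hcf, he⟩ := span_add hrel (span_smul hds hsum)
    refine ⟨k, ρ, cf, hρ, hcf, ?_⟩
    rw [← he, smul_sub, Finset.smul_sum]
    simp_rw [smul_smul]
    abel
  -- the endgame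
  exact manyPathsCore_endgame L hL hALT DU hli hpts (fun x : Bs => (x : ℂ)) hliB halgB ℓ hℓper c hc
    A B (fun s i => d s * ((q s i : ℚ) : ℂ)) e hAalg hBalg hqalg (fun s hs => (hkey s hs).2.2.2.1)
    hper_s h0

end Summit.KontsevichZagierPeriods.SymplecticScissors.RealOnePeriodRelations.MultiEllLayer

end
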